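import Mathlib
import Summits.NavierStokesRegularity.NavierStokesRegularity.Theorems.TaoLadderRungTwoFlatBehindHopClosed
import Summits.NavierStokesRegularity.NavierStokesRegularity.Theorems.TaoLadderRungTwoFlatBootstrap
import HarnessLib

/-!
# The BEHIND-ZONE in-hop a-priori bound by continuous induction (L-54f): the clock-weighted amplitude `A_eff` on every behind
  bond during the hop from the initial block energies, the top input and the transport inequality itself; and the behind
  hop CLOSED modulo the named schedule hypotheses (helper for the K_A♭ parent item stmt-NavierStokesRegularity-22987
  `FlatGapCertificatesV2`, child 2A `GradedAdiabaticWakeA` of route TaoLadderRungTwoFlat; cell harvest/h2-tao-ladder, p1 g23;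
  theory-1 g42 asks L-54f / (B2) cap, LADDER §54.9)

The transport inequality for the behind blocks (`R54.behind_hop_of_pseudoFlow`, L-54b) consumes a clock-weighted amplitude bound
`clock·|S| ≤ A_eff` on every behind bond DURING the hop (its rate is `μ ≤ σθ′ − 2(1+ε)A_eff sinh(θ′/2)`). That bound is itself a
consequence of the block energies: a shell `k` of the landing block `[1−K−L, −K]` with `V_L(t) ≤ V̄` has
`|S_{ik}(t)| ≤ √(2V̄)·e^{θ′((−K+σt) − k)/2}` and, for the SLOW exponent `θ′ ≤ 5·log(1+ε₀)` (`θ_b′ ≤ 5/2`), the clock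
`(1+ε₀)^{5k/2}` absorbs the growth of that allowance with the depth: `clock·|S_{ik}(t)| ≤ √(2V̄)·e^{θ′/2}`
(`clockWeighted_le_of_blockEnergy_le`; cf. theory-1's `R54.clockWeighted_le_one`). The loop "energy ⇒ amplitude ⇒ rate ⇒
energy" is strict at `t = 0` and continuous in `t`, so it closes by CONTINUOUS INDUCTION (`Bootstrap.Icc_induction`) on ONE deep
block `L⋆`: shells below `L⋆` are harmless because the flow's own qualitative bound `Λ` (format clause (4.5), field
`apriori_S`) times the deep clock is as small as we please (`R54.clock_bottom_eventually_le`, `0 < ε₀`), and the bottom input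
of the block `L⋆` is `(1+ε)Λ³·clock → 0` likewise (L-55b).

* `clock_mul_exp_le`, `abs_le_of_blockEnergy_le`, `clockWeighted_le_of_blockEnergy_le` — the extraction;
* `behind_apriori_of_pseudoFlow` — **the in-hop a-priori bound**: initial block energies `≤ V₀`, weighted top flux `≤ Ē_top`,
  the core's bottom carrier `|a_{1−K}| ≤ A₀ ≤ A_eff`, a rate `0 < μ ≤ σθ′ − 2(1+ε)A_eff sinh(θ′/2)` and the closing conditions
  `V₀ + Ē_top/μ < V̄`, `√(2V̄)·e^{θ′/2} ≤ A_eff` ⇒ `clock·|S| ≤ A_eff` on every behind bond for all `t ∈ [0, τ₁]`;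
* `behindEnergyClause_hop_of_schedule` — **the behind hop CLOSED modulo the named schedule hypotheses**: the (B1) clause of the
  tube state (`W n`), its bottom-shell amplitude `a_K`, the kick `r_k`, the two interface amplitudes `A₁` (near) and `A₀` (core)
  during the hop, the rate level `A_eff`, and three scalar inequalities (closing level, closing gauge, budget) ⇒
  `BehindEnergyClause K θ′ W′ (recentre S τ₁ a)` — no free a-priori hypothesis on the behind zone itself.

HONEST FRAMING: inequalities about MODEL-lattice certificate flows (graded mirror table on `S♭`, `m = 2`); the interface
amplitudes and the scalar schedule inequalities are HYPOTHESES; nothing certified; no item closed; nothing about the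
Navier–Stokes equations.
-/

noncomputable section

-- the sub-problem namespace repeats the summit name by design (D-0017)
set_option linter.dupNamespace false

namespace Summit.NavierStokesRegularity.NavierStokesRegularity.Theorems.HopTube.R54

open Set Finset Literature.Analysis.FluidPDE Literature.Analysis.FluidPDE.TaoCascade MirrorPulse

/-! ## Extraction: block energy ⇒ clock-weighted amplitude -/

/-- **The clock absorbs the depth allowance of the slow weight**: for `k ≤ −K`, `d ≤ 1`, `0 ≤ θ′ ≤ 5·log(1+ε₀)`:
`clock(k)·e^{θ′((−K+d) − k)/2} ≤ e^{θ′/2}`. [cite: Tao2016AveragedNS, §4 (4.1) (clock scaling); route TaoLadderRungTwoFlat, R54-1 / L-54a (cell LADDER §54)] -/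
theorem clock_mul_exp_le {ε₀ θ' d : ℝ} (hε₀ : 0 ≤ ε₀) (hθ : 0 ≤ θ') (hθ5 : θ' ≤ 5 * Real.log (1 + ε₀))
    (hd1 : d ≤ 1) {K : ℕ} {k : ℤ} (hk : k ≤ -(K : ℤ)) :
    clock ε₀ k * Real.exp (θ' * ((-(K : ℝ) + d) - k) / 2) ≤ Real.exp (θ' / 2) := by
  have hℓ : 0 ≤ Real.log (1 + ε₀) := Real.log_nonneg (by linarith)
  have hclock : clock ε₀ k = Real.exp (Real.log (1 + ε₀) * ((5 : ℝ) * k / 2)) := by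
    unfold clock
    rw [Real.rpow_def_of_pos (by linarith)]
  rw [hclock, ← Real.exp_add, Real.exp_le_exp]
  have hkR : (k : ℝ) ≤ -(K : ℝ) := by exact_mod_cast hk
  have hK : (0 : ℝ) ≤ K := Nat.cast_nonneg K
  have h1 : θ' * (-(K : ℝ) - k) ≤ 5 * Real.log (1 + ε₀) * (-(K : ℝ) - k) :=
    mul_le_mul_of_nonneg_right hθ5 (by linarith)
  have h2 : θ' * d ≤ θ' := by nlinarith
  have h3 : 0 ≤ Real.log (1 + ε₀) * (K : ℝ) := mul_nonneg hℓ hK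
  nlinarith

/-- **Sup extraction from a block energy**: `V_s(t) ≤ V̄` with edge `n_e` gives `|S_{ik}(t)| ≤ √(2V̄)·e^{θ′(n_e − k)/2}` on the
block. [cite: Tao2016AveragedNS, §4 (4.3); route TaoLadderRungTwoFlat, L-54a (cell LADDER §54)] -/
theorem abs_le_of_blockEnergy_le {θ' ne Vbar : ℝ} {s : Finset ℤ} {S : Fin 2 → ℤ → ℝ → ℝ} {t : ℝ}
    (hV : coMovingEnergyOn s θ' ne S t ≤ Vbar) (i : Fin 2) {k : ℤ} (hk : k ∈ s) :
    |S i k t| ≤ Real.sqrt (2 * Vbar) * Real.exp (θ' * (ne - k) / 2) := by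
  have h1 := sq_le_exp_mul_coMovingEnergyOn s θ' ne S t hk i
  have hV0 : 0 ≤ Vbar := (coMovingEnergyOn_nonneg _ _ _ _ _).trans hV
  have hsq : Real.exp (θ' * (ne - k) / 2) ^ 2 = Real.exp (θ' * (ne - k)) := by
    rw [sq, ← Real.exp_add, add_halves]
  have h2 : S i k t ^ 2 ≤ (Real.sqrt (2 * Vbar) * Real.exp (θ' * (ne - k) / 2)) ^ 2 := by
    rw [mul_pow, Real.sq_sqrt (by linarith), hsq]
    have := mul_le_mul_of_nonneg_left hV (Real.exp_pos (θ' * (ne - k))).le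
    nlinarith
  exact abs_le.mpr (abs_le_of_sq_le_sq' h2 (by positivity))

/-- **Clock-weighted amplitude from the landing-block energy**: on `[1−K−L, −K]` with edge `−K + σt`, `σt ≤ 1`,
`V_L(t) ≤ V̄` and `0 ≤ θ′ ≤ 5·log(1+ε₀)`: `clock(n)·|S_{ik}(t)| ≤ √(2V̄)·e^{θ′/2}` for every bond `n ≤ k` (the shell's own bond
`n = k` and the bond below, `n = k − 1`). [cite: Tao2016AveragedNS, §4 (4.1), (4.3); route TaoLadderRungTwoFlat, L-54a/L-54b (cell LADDER §54)] -/
theorem clockWeighted_le_of_blockEnergy_le {ε₀ θ' σ Vbar : ℝ} (hε₀ : 0 ≤ ε₀) (hθ : 0 ≤ θ')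
    (hθ5 : θ' ≤ 5 * Real.log (1 + ε₀)) {K L : ℕ} {S : Fin 2 → ℤ → ℝ → ℝ} {t : ℝ} (hσt1 : σ * t ≤ 1)
    (hV : coMovingEnergyOn (Finset.Icc (1 - (K : ℤ) - L) (-(K : ℤ))) θ' (-(K : ℝ) + σ * t) S t ≤ Vbar)
    (i : Fin 2) {k : ℤ} (hk : k ∈ Finset.Icc (1 - (K : ℤ) - L) (-(K : ℤ))) {n : ℤ} (hn : n ≤ k) :
    clock ε₀ n * |S i k t| ≤ Real.sqrt (2 * Vbar) * Real.exp (θ' / 2) := by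
  have hkK : k ≤ -(K : ℤ) := (Finset.mem_Icc.mp hk).2
  have h1 := abs_le_of_blockEnergy_le hV i hk
  have hc := clock_mono hε₀ hn
  have hc0 : 0 ≤ clock ε₀ n := clock_nonneg (by linarith) _
  have h2 := clock_mul_exp_le hε₀ hθ hθ5 hσt1 hkK
  have hs0 : 0 ≤ Real.sqrt (2 * Vbar) := Real.sqrt_nonneg _
  calc clock ε₀ n * |S i k t|
      ≤ clock ε₀ k * (Real.sqrt (2 * Vbar) * Real.exp (θ' * ((-(K : ℝ) + σ * t) - k) / 2)) :=
        mul_le_mul hc h1 (abs_nonneg _) (clock_nonneg (by linarith) _)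
    _ = Real.sqrt (2 * Vbar) * (clock ε₀ k * Real.exp (θ' * ((-(K : ℝ) + σ * t) - k) / 2)) := by ring
    _ ≤ Real.sqrt (2 * Vbar) * Real.exp (θ' / 2) := mul_le_mul_of_nonneg_left h2 hs0

/-! ## The bootstrap -/

section Apriori

variable {ε ε₀ τ κ₂ : ℝ} {S₀ F₀ B₀ : Fin 2 → ℤ → ℝ} {S F : Fin 2 → ℤ → ℝ → ℝ}

set_option maxHeartbeats 400000 in
/-- **THE BEHIND-ZONE IN-HOP A-PRIORI BOUND (L-54f) by continuous induction.** See the module docstring.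
[cite: Tao2016AveragedNS, §4 (4.1), (4.3), (4.5), (4.8), §5 (continuity argument, statement shape); route TaoLadderRungTwoFlat, R54-1 (B1)/(B2), L-54b/L-54f (cell LADDER §54.9)] -/
theorem behind_apriori_of_pseudoFlow
    (hS : PseudoFlowOnShift shiftSetFlat τ ε₀ (mirrorTable ε ε) 0 κ₂ S₀ F₀ B₀ S F)
    (hε : 0 ≤ ε) (hε₀ : 0 < ε₀) {K : ℕ} {θ' σ τ₁ Aeff A₀ μ Etop V₀ Vbar : ℝ} (hθ : 0 ≤ θ')
    (hθ5 : θ' ≤ 5 * Real.log (1 + ε₀)) (hAeff : 0 < Aeff) (hτ₁ : 0 < τ₁) (hτ₁τ : τ₁ ≤ τ) (hστ : σ * τ₁ = 1)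
    (hA₀ : ∀ t ∈ Icc 0 τ₁, |S 0 (-(K : ℤ) + 1) t| ≤ A₀) (hA₀le : A₀ ≤ Aeff)
    (hEtop : ∀ t ∈ Ioo 0 τ₁,
      Real.exp (θ' * ((((-(K : ℤ)) : ℤ) : ℝ) - (-(K : ℝ) + σ * t))) * |fluxT ε ε₀ S (-(K : ℤ)) t| ≤ Etop)
    (hEtop0 : 0 ≤ Etop)
    (hV₀ : ∀ L : ℕ, coMovingEnergyOn (Finset.Icc (1 - (K : ℤ) - L) (-(K : ℤ))) θ' (-(K : ℝ)) S 0 ≤ V₀)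
    (hμ : 0 < μ) (hμle : μ ≤ σ * θ' - 2 * (1 + ε) * Aeff * Real.sinh (θ' / 2))
    (hVbar : V₀ + Etop / μ < Vbar) (hclose : Real.sqrt (2 * Vbar) * Real.exp (θ' / 2) ≤ Aeff) :
    ∀ t ∈ Icc 0 τ₁, ∀ n : ℤ, n ≤ -(K : ℤ) →
      clock ε₀ n * |S 1 n t| ≤ Aeff ∧ clock ε₀ n * |S 0 (n + 1) t| ≤ Aeff := by
  have hσ : 0 < σ := pos_of_mul_pos_left (by rw [hστ]; exact one_pos) hτ₁.le
  have hε₀' : (-1 : ℝ) ≤ ε₀ := by linarith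
  have hV₀0 : 0 ≤ V₀ := (coMovingEnergyOn_nonneg _ _ _ _ _).trans (hV₀ 0)
  -- the flow's own qualitative a-priori bound `Λ` (format clause (4.5)) on `[0, τ]`
  obtain ⟨M, hM⟩ := hS.apriori_S
  have hΛ : ∀ t ∈ Icc 0 τ₁, ∀ (i : Fin 2) (k : ℤ), |S i k t| ≤ max M 0 := by
    intro t ht i k
    have ht' : t ∈ Icc 0 τ := ⟨ht.1, ht.2.trans hτ₁τ⟩
    have h1 := hM t ht' i k
    have hp : 0 < (1 + ε₀) ^ ((10 : ℝ) * k) := Real.rpow_pos_of_pos (by linarith) _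
    have h2 : |S i k t| ≤ (1 + (1 + ε₀) ^ ((10 : ℝ) * k)) * |S i k t| :=
      le_mul_of_one_le_left (abs_nonneg _) (by linarith)
    exact (h2.trans h1).trans (le_max_left _ _)
  set Λ : ℝ := max M 0 with hΛdef
  have hΛ0 : 0 ≤ Λ := le_max_right _ _
  -- the gap and the deep threshold
  set η' : ℝ := (Vbar - (V₀ + Etop / μ)) / 2 with hη'def
  have hη'0 : 0 < η' := by rw [hη'def]; linarith
  obtain ⟨L₀, hL₀⟩ := clock_bottom_eventually_le hε₀ K
    (min (Aeff / (Λ + 1)) (η' * μ / ((1 + ε) * Λ ^ 3 + 1))) (lt_min (by positivity) (by positivity))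
  -- deep shells: small clocks
  have hdeep : ∀ m : ℤ, m ≤ -(K : ℤ) - L₀ - 1 →
      clock ε₀ m ≤ min (Aeff / (Λ + 1)) (η' * μ / ((1 + ε) * Λ ^ 3 + 1)) := by
    intro m hm
    obtain ⟨L, hL⟩ : ∃ L : ℕ, (L : ℤ) = -(K : ℤ) - m := ⟨(-(K : ℤ) - m).toNat, Int.toNat_of_nonneg (by omega)⟩
    have h := hL₀ L (by omega)
    have e : (1 - (K : ℤ) - L - 1) = m := by omega
    rwa [e] at h
  have hdeepA : ∀ m : ℤ, m ≤ -(K : ℤ) - L₀ - 1 → ∀ t ∈ Icc 0 τ₁, ∀ i : Fin 2, ∀ n : ℤ, n ≤ m →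
      clock ε₀ n * |S i m t| ≤ Aeff := by
    intro m hm t ht i n hn
    have hc : clock ε₀ n ≤ Aeff / (Λ + 1) :=
      ((clock_mono hε₀.le hn).trans (hdeep m hm)).trans (min_le_left _ _)
    have hc0 : 0 ≤ clock ε₀ n := clock_nonneg hε₀' _
    calc clock ε₀ n * |S i m t| ≤ Aeff / (Λ + 1) * Λ := mul_le_mul hc (hΛ t ht i m) (abs_nonneg _) (by positivity)
      _ ≤ Aeff := by
          rw [div_mul_eq_mul_div, div_le_iff₀ (by positivity)]
          nlinarith
  -- the one deep block `L⋆ = L₀ + 1`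
  set Lstar : ℕ := L₀ + 1 with hLstar
  have hL1 : 1 ≤ Lstar := by omega
  -- energy level `≤ V̄` on the block `L⋆` at time `t` ⇒ clock-weighted amplitude `≤ A_eff` on EVERY behind bond at time `t`
  have hamp : ∀ t ∈ Icc 0 τ₁,
      coMovingEnergyOn (Finset.Icc (1 - (K : ℤ) - Lstar) (-(K : ℤ))) θ' (-(K : ℝ) + σ * t) S t ≤ Vbar →
        ∀ n : ℤ, n ≤ -(K : ℤ) → clock ε₀ n * |S 1 n t| ≤ Aeff ∧ clock ε₀ n * |S 0 (n + 1) t| ≤ Aeff := by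
    intro t ht hV n hn
    have hσt1 : σ * t ≤ 1 := by nlinarith [ht.2]
    have hblock : ∀ (i : Fin 2) (k : ℤ), k ∈ Finset.Icc (1 - (K : ℤ) - Lstar) (-(K : ℤ)) → ∀ n' : ℤ, n' ≤ k →
        clock ε₀ n' * |S i k t| ≤ Aeff := fun i k hk n' hn' =>
      (clockWeighted_le_of_blockEnergy_le hε₀.le hθ hθ5 hσt1 hV i hk hn').trans hclose
    constructor
    · -- species 1 at shell `n`
      by_cases hcase : 1 - (K : ℤ) - Lstar ≤ n
      · exact hblock 1 n (Finset.mem_Icc.mpr ⟨hcase, hn⟩) n le_rfl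
      · exact hdeepA n (by omega) t ht 1 n le_rfl
    · -- species 0 at shell `n + 1`
      rcases eq_or_lt_of_le hn with heq | hlt
      · -- the core's bottom carrier
        rw [heq]
        have hc1 : clock ε₀ (-(K : ℤ)) ≤ 1 := by
          have h := clock_mono hε₀.le (show (-(K : ℤ)) ≤ 0 by omega)
          have h0 : clock ε₀ 0 = 1 := by unfold clock; simp
          rwa [h0] at h
        have hc0 : 0 ≤ clock ε₀ (-(K : ℤ)) := clock_nonneg hε₀' _
        calc clock ε₀ (-(K : ℤ)) * |S 0 (-(K : ℤ) + 1) t| ≤ 1 * A₀ :=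
              mul_le_mul hc1 (hA₀ t ht) (abs_nonneg _) zero_le_one
          _ ≤ Aeff := by linarith
      · by_cases hcase : 1 - (K : ℤ) - Lstar ≤ n + 1
        · exact hblock 0 (n + 1) (Finset.mem_Icc.mpr ⟨hcase, by omega⟩) n (by omega)
        · exact hdeepA (n + 1) (by omega) t ht 0 n (by omega)
  -- continuous induction on the block energy of `L⋆`
  have haP : (1 - (K : ℤ) - Lstar) ≤ -(K : ℤ) := by omega
  have hcont : ContinuousOn
      (fun t => coMovingEnergyOn (Finset.Icc (1 - (K : ℤ) - Lstar) (-(K : ℤ))) θ' (-(K : ℝ) + σ * t) S t)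
      (Icc 0 τ₁) :=
    continuousOn_coMovingEnergyOn _ fun i n _ =>
      (QuadPolar.continuousOn_of_pseudoFlowOnShift hS i n).mono (Icc_subset_Icc le_rfl hτ₁τ)
  have h0 : coMovingEnergyOn (Finset.Icc (1 - (K : ℤ) - Lstar) (-(K : ℤ))) θ' (-(K : ℝ) + σ * 0) S 0
      ≤ V₀ + Etop / μ + η' := by
    rw [mul_zero, add_zero]
    have := hV₀ Lstar
    have : 0 ≤ Etop / μ := by positivity
    linarith
  have hba : V₀ + Etop / μ + η' < Vbar := by rw [hη'def]; linarith
  have key := Bootstrap.Icc_induction (T := τ₁) (a := Vbar) (b := V₀ + Etop / μ + η') hτ₁.le hcont hba h0 ?_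
  · -- conclusion
    intro t ht n hn
    exact hamp t ht ((key t ht).trans hba.le) n hn
  · -- the step: energies `≤ V̄` on `[0, t]` ⇒ rate valid on `(0, t)` ⇒ transport ⇒ energy `≤ b` at `t`
    intro t ht hpast
    have hbd : ∀ s ∈ Ioo 0 t, ∀ n ∈ Finset.Icc (1 - (K : ℤ) - Lstar - 1) (-(K : ℤ)),
        clock ε₀ n * |S 1 n s| ≤ Aeff ∧ clock ε₀ n * |S 0 (n + 1) s| ≤ Aeff := by
      intro s hs n hn
      have hs' : s ∈ Icc 0 τ₁ := ⟨hs.1.le, hs.2.le.trans ht.2⟩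
      exact hamp s hs' (hpast s ⟨hs.1.le, hs.2.le⟩) n (Finset.mem_Icc.mp hn).2
    have hE : ∀ s ∈ Ioo 0 t,
        Real.exp (θ' * ((((1 - (K : ℤ) - Lstar : ℤ)) : ℝ) - (-(K : ℝ) + σ * s)))
            * |fluxT ε ε₀ S (1 - (K : ℤ) - Lstar - 1) s|
          + Real.exp (θ' * ((((-(K : ℤ)) : ℤ) : ℝ) - (-(K : ℝ) + σ * s))) * |fluxT ε ε₀ S (-(K : ℤ)) s|
          ≤ η' * μ + Etop := by
      intro s hs
      have hs' : s ∈ Icc 0 τ₁ := ⟨hs.1.le, hs.2.le.trans ht.2⟩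
      have hσs : 0 ≤ σ * s := (mul_pos hσ hs.1).le
      have hbot := weighted_bottomFlux_le (θ' := θ') (σ := σ) (K := K) hε hε₀' hθ hL1 S hσs hΛ0
        (hΛ s hs' 1 _) (hΛ s hs' 0 _)
      have hcl : clock ε₀ (1 - (K : ℤ) - Lstar - 1) ≤ η' * μ / ((1 + ε) * Λ ^ 3 + 1) :=
        (hdeep _ (by omega)).trans (min_le_right _ _)
      have hbot' : (1 + ε) * Λ ^ 3 * clock ε₀ (1 - (K : ℤ) - Lstar - 1) ≤ η' * μ := by
        calc (1 + ε) * Λ ^ 3 * clock ε₀ (1 - (K : ℤ) - Lstar - 1)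
            ≤ (1 + ε) * Λ ^ 3 * (η' * μ / ((1 + ε) * Λ ^ 3 + 1)) := mul_le_mul_of_nonneg_left hcl (by positivity)
          _ ≤ η' * μ := by
              rw [← mul_div_assoc, div_le_iff₀ (by positivity)]
              nlinarith [mul_pos hη'0 hμ]
      have htop := hEtop s ⟨hs.1, hs.2.trans_le ht.2⟩
      linarith
    have htr := coMovingEnergyOn_transport_of_pseudoFlow (θ := θ') (σ := σ) (n₀ := -(K : ℝ)) hS hε hε₀' hθ
      hAeff.le haP le_rfl ht.1 (ht.2.trans hτ₁τ) hbd hE hμ hμle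
    rw [sub_zero, mul_zero, add_zero] at htr
    have he1 : Real.exp (-μ * t) ≤ 1 := by rw [Real.exp_le_one_iff]; nlinarith [ht.1]
    have he0 : 0 ≤ Real.exp (-μ * t) := (Real.exp_pos _).le
    have hf0 : 0 ≤ coMovingEnergyOn (Finset.Icc (1 - (K : ℤ) - Lstar) (-(K : ℤ))) θ' (-(K : ℝ)) S 0 :=
      coMovingEnergyOn_nonneg _ _ _ _ _
    have hf0' := hV₀ Lstar
    have hI : (η' * μ + Etop) * (1 - Real.exp (-μ * t)) / μ ≤ (η' * μ + Etop) / μ := by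
      apply div_le_div_of_nonneg_right _ hμ.le
      nlinarith [mul_pos hη'0 hμ]
    have hI' : (η' * μ + Etop) / μ = η' + Etop / μ := by field_simp
    calc coMovingEnergyOn (Finset.Icc (1 - (K : ℤ) - Lstar) (-(K : ℤ))) θ' (-(K : ℝ) + σ * t) S t
        ≤ Real.exp (-μ * t) * coMovingEnergyOn (Finset.Icc (1 - (K : ℤ) - Lstar) (-(K : ℤ))) θ' (-(K : ℝ)) S 0
            + (η' * μ + Etop) * (1 - Real.exp (-μ * t)) / μ := htr
      _ ≤ 1 * V₀ + (η' * μ + Etop) / μ := add_le_add (mul_le_mul he1 hf0' hf0 zero_le_one) hI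
      _ = V₀ + Etop / μ + η' := by rw [hI']; ring

/-- **THE BEHIND HOP CLOSED MODULO THE NAMED SCHEDULE HYPOTHESES.** Along one exact graded window flow (`0 < ε₀`, slow exponent
`0 < θ′ ≤ 5·log(1+ε₀)`, `στ₁ = 1`): the (B1) clause `BehindEnergyClause K θ′ (W n) z` of the tube state, its bottom-shell
amplitude `a_K`, the kick `|S₀ − z| ≤ r_k` behind, the interface amplitudes `|v_{−K}| ≤ A₁` (near zone) and `|a_{1−K}| ≤ A₀`
(core bottom) during the hop, a rate level `A_eff ≥ A₀` with `0 < μ ≤ σθ′ − 2(1+ε)A_eff sinh(θ′/2)`, and the scalar inequalities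
(closing level) `V₀ + Ē_top/μ < V̄`, (closing gauge) `√(2V̄)e^{θ′/2} ≤ A_eff`, (budget) `e^{−μτ₁}V₀ + Ē_top(1−e^{−μτ₁})/μ ≤ a²W′`
with `V₀ := (√(W n + a_K²) + r_k/√(1−e^{−θ′}))²`, `Ē_top := A₁A₀(A₁+εA₀)` give `BehindEnergyClause K θ′ W′ (recentre S τ₁ a)`.
[cite: Tao2016AveragedNS, §4 (4.1), (4.3), (4.5), (4.8), §6.3–6.4 (statement shape); route TaoLadderRungTwoFlat, `HopTube.TubeStepBehind` under R54-1 (cell LADDER §54–§55)] -/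
theorem behindEnergyClause_hop_of_schedule
    (hS : PseudoFlowOnShift shiftSetFlat τ ε₀ (mirrorTable ε ε) 0 κ₂ S₀ F₀ B₀ S F)
    (hε : 0 ≤ ε) (hε₀ : 0 < ε₀) {K : ℕ} {θ' σ τ₁ a Aeff A₁ A₀ μ Wn aK rk Vbar W' : ℝ} {z : Fin 2 → ℤ → ℝ}
    (hθ : 0 < θ') (hθ5 : θ' ≤ 5 * Real.log (1 + ε₀)) (hAeff : 0 < Aeff) (hτ₁ : 0 < τ₁) (hτ₁τ : τ₁ ≤ τ)
    (hστ : σ * τ₁ = 1) (ha : 0 < a)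
    (hW : BehindEnergyClause K θ' Wn z) (hWn : 0 ≤ Wn) (haK : ∀ i, |z i (-(K : ℤ))| ≤ aK)
    (hkick : ∀ (i : Fin 2) (k : ℤ), k ≤ -(K : ℤ) → |S₀ i k - z i k| ≤ rk) (hrk : 0 ≤ rk)
    (hA₁ : ∀ t ∈ Ioo 0 τ₁, |S 1 (-(K : ℤ)) t| ≤ A₁) (hA₀ : ∀ t ∈ Icc 0 τ₁, |S 0 (-(K : ℤ) + 1) t| ≤ A₀)
    (hA₀le : A₀ ≤ Aeff) (hμ : 0 < μ) (hμle : μ ≤ σ * θ' - 2 * (1 + ε) * Aeff * Real.sinh (θ' / 2))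
    (hlevel : (Real.sqrt (Wn + aK ^ 2) + rk / Real.sqrt (1 - Real.exp (-θ'))) ^ 2
        + A₁ * A₀ * (A₁ + ε * A₀) / μ < Vbar)
    (hclose : Real.sqrt (2 * Vbar) * Real.exp (θ' / 2) ≤ Aeff)
    (hbudget : Real.exp (-μ * τ₁) * (Real.sqrt (Wn + aK ^ 2) + rk / Real.sqrt (1 - Real.exp (-θ'))) ^ 2
        + A₁ * A₀ * (A₁ + ε * A₀) * (1 - Real.exp (-μ * τ₁)) / μ ≤ a ^ 2 * W') :
    BehindEnergyClause K θ' W' (recentre S τ₁ a) := by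
  have hσ : 0 < σ := pos_of_mul_pos_left (by rw [hστ]; exact one_pos) hτ₁.le
  have hV₀ : ∀ L : ℕ, coMovingEnergyOn (Finset.Icc (1 - (K : ℤ) - L) (-(K : ℤ))) θ' (-(K : ℝ)) S 0
      ≤ (Real.sqrt (Wn + aK ^ 2) + rk / Real.sqrt (1 - Real.exp (-θ'))) ^ 2 := fun L =>
    initial_blockEnergy_le_additive hS.init_S hθ hW hWn haK (fun i k hk => hkick i k (Finset.mem_Icc.mp hk).2) hrk
  have hEtop : ∀ t ∈ Ioo 0 τ₁,
      Real.exp (θ' * ((((-(K : ℤ)) : ℤ) : ℝ) - (-(K : ℝ) + σ * t))) * |fluxT ε ε₀ S (-(K : ℤ)) t|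
        ≤ A₁ * A₀ * (A₁ + ε * A₀) := fun t ht =>
    weighted_topFlux_le hε hε₀.le hθ.le K S (mul_pos hσ ht.1).le (hA₁ t ht) (hA₀ t ⟨ht.1.le, ht.2.le⟩)
  have hEtop0 : 0 ≤ A₁ * A₀ * (A₁ + ε * A₀) := by
    have ht : τ₁ / 2 ∈ Ioo 0 τ₁ := ⟨by linarith, by linarith⟩
    exact le_trans (by positivity) (hEtop (τ₁ / 2) ht)
  have hbd := behind_apriori_of_pseudoFlow hS hε hε₀ hθ.le hθ5 hAeff hτ₁ hτ₁τ hστ hA₀ hA₀le hEtop hEtop0 hV₀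
    hμ hμle hlevel hclose
  exact behindEnergyClause_hop_topInput hS hε hε₀ hθ.le hAeff.le hτ₁ hτ₁τ hστ ha
    (fun t ht n hn => hbd t ⟨ht.1.le, ht.2.le⟩ n hn) hEtop hV₀ hbudget hμ hμle

end Apriori

end Summit.NavierStokesRegularity.NavierStokesRegularity.Theorems.HopTube.R54

end
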